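import Literature.MathematicalPhysics.KineticTheory.CollisionTubePullbackPathwise
import Literature.MathematicalPhysics.KineticTheory.CollisionTubePullbackPacking
import Summits.AtomisticToContinuum.HydrodynamicLimit.Theorems.JParityClosureEvenStressEnskogTubeStatRegular
import Summits.AtomisticToContinuum.HydrodynamicLimit.Theorems.ImplosionDichotomyHsEosLowDensity
import HarnessLib

/-!
# `cylinderPullback_rung0_of_residuals`: the cylinder pull-back at RUNG 0 (constant profiles) from its
# three residual concentrations (helper stub of the crux line `even-rung-mean-variance`,
# `JParityClosure.EvenStressEnskog`, stmt-AtomisticToContinuum-13079)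

Constant-profile restriction of the two glue stubs `stub_cylinderPullbackOfResiduals` (S2b₁–S2b₃ ⇒ S2\*)
and `stub_cylinderPullbackOfStar` (S2\* ⇒ S2): both proofs are pointwise in the profile `(a₀, u₀, θ₀)`, so
the same arguments with `(fun _ => a, fun _ => u, fun _ => θ)` give
`cylinderPullback_rung0_of_residuals : (S2b₁)₀ → (S2b₂)₀ → (S2b₃)₀ → S2|const` — the pathwise pull-back
`cylinderPullback_pathwise` on the good set, the packing bound `residual_latePairs`, a union bound, and the
exact Enskog slicing `evenStat_sub_evenTubeTimeStat_eq` along good orbits (integrability from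
`stub_evenTubeStatRegular` fed with `Theorems.hsEosLowDensity_proof`, and `Theorems.measurable_tubeStat_uncurry`
/ `Theorems.exists_bound_tubeStat`).
-/

noncomputable section

open scoped BigOperators Classical InnerProductSpace ENNReal Topology
open Set MeasureTheory Filter Function

namespace Summit.AtomisticToContinuum.HydrodynamicLimit.Theorems.EvenStressEnskog

open Literature.Analysis.FluidPDE Literature.MathematicalPhysics.KineticTheory

/-- Elementary: `x · η/(4(x+1)) ≤ η/4` for `x, η ≥ 0`. [folklore] -/
private theorem mul_eta_div_le_r0 {x η : ℝ} (hx : 0 ≤ x) (hη : 0 ≤ η) : x * (η / (4 * (x + 1))) ≤ η / 4 := by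
  rw [show x * (η / (4 * (x + 1))) = η / 4 * (x / (x + 1)) by field_simp]
  exact mul_le_of_le_one_right (by positivity) ((div_le_one (by linarith)).2 (by linarith))

/-- The equation of state of the route `JParityClosure` (identical body to the proved
`ImplosionDichotomy.HsEosLowDensity`). [folklore] -/
private theorem hsEos_jParity_r0 :
    Summit.AtomisticToContinuum.HydrodynamicLimit.Theses.JParityClosure.HsEosLowDensity :=
  Summit.AtomisticToContinuum.HydrodynamicLimit.Theorems.hsEosLowDensity_proof

/-- **Integrability of the tube functional and of the Enskog rate along good orbits.**  For `σ > 0`,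
continuous `χ, g` with `g = 0` on `[η₆, ∞)` (`η₆` the threshold of S6), `L ≥ 0`, `r > 0`, `κ ≥ 0`:
along the orbit of every good `z`, `t ↦ A_t(Φ_t z)` and `t ↦ e_t(Φ_t z)` are integrable on `[0, τ]`.
[folklore] -/
private theorem integrableOn_A_e_orbit_r0 {η₆ : ℝ}
    (H6 : ∀ (σ : ℝ) (N : ℕ) (χ : ℝ × UnitAddTorus (Fin 3) → ℝ) (g : ℝ → ℝ) (k l : Fin 3) (L r κ τ : ℝ),
      0 < σ → Continuous χ → Continuous g → (∀ a, η₆ ≤ a → g a = 0) → 0 ≤ L → 0 < r → 0 ≤ κ →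
      Measurable (fun p : ℝ × Config (N + 1) (Fin 3) T3 => evenTubeStat σ N χ g (evenMarkTrunc k l L) r κ p.1 p.2) ∧
      ∃ B : ℝ, ∀ t ∈ Set.Icc (0 : ℝ) τ, ∀ z : Config (N + 1) (Fin 3) T3,
        |evenTubeStat σ N χ g (evenMarkTrunc k l L) r κ t z| ≤ B)
    {σ : ℝ} {N : ℕ} {Φ : HardSphereFlow (Torus.geometry (Fin 3)) (hsDiameter σ N) (N + 1)}
    {z : Config (N + 1) (Fin 3) T3} (hz : z ∈ Φ.good) {χ : ℝ × UnitAddTorus (Fin 3) → ℝ} {g : ℝ → ℝ}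
    (k l : Fin 3) {L r κ τ : ℝ} (hσ : 0 < σ) (hχ : Continuous χ) (hg : Continuous g)
    (hg6 : ∀ a, η₆ ≤ a → g a = 0) (hL : 0 ≤ L) (hr : 0 < r) (hκ : 0 ≤ κ) :
    IntegrableOn (fun t => tubeStat σ N χ g (evenMarkTrunc k l L) r r 1 κ t (Φ.flow t z)) (Icc 0 τ) ∧
      IntegrableOn (fun t => enskogRate σ N χ g (evenMarkTrunc k l L) r t (Φ.flow t z)) (Icc 0 τ) := by
  have hΨc := continuous_evenMarkTrunc k l L
  have hA := Theorems.measurable_tubeStat_uncurry σ N hχ hg hΨc r r 1 κ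
  obtain ⟨BA, hBA⟩ := Theorems.exists_bound_tubeStat σ N hχ hg (exists_abs_evenMarkTrunc_le k l hL) hr r
    zero_le_one hκ τ
  obtain ⟨hW, BW, hBW⟩ := H6 σ N χ g k l L r κ τ hσ hχ hg hg6 hL hr hκ
  have hσ3 : 0 < σ ^ 3 := by positivity
  -- `e = σ⁻³ (A − W)`
  have he_eq : ∀ (t : ℝ) (ζ : Config (N + 1) (Fin 3) T3), enskogRate σ N χ g (evenMarkTrunc k l L) r t ζ =
      (σ ^ 3)⁻¹ * (tubeStat σ N χ g (evenMarkTrunc k l L) r r 1 κ t ζ -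
        evenTubeStat σ N χ g (evenMarkTrunc k l L) r κ t ζ) := by
    intro t ζ
    rw [evenTubeStat_def, sub_sub_cancel, ← mul_assoc, inv_mul_cancel₀ hσ3.ne', one_mul]
  have hE : Measurable (fun p : ℝ × Config (N + 1) (Fin 3) T3 => enskogRate σ N χ g (evenMarkTrunc k l L) r p.1 p.2) := by
    have : (fun p : ℝ × Config (N + 1) (Fin 3) T3 => enskogRate σ N χ g (evenMarkTrunc k l L) r p.1 p.2) =
        fun p => (σ ^ 3)⁻¹ * (tubeStat σ N χ g (evenMarkTrunc k l L) r r 1 κ p.1 p.2 -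
          evenTubeStat σ N χ g (evenMarkTrunc k l L) r κ p.1 p.2) := funext fun p => he_eq p.1 p.2
    rw [this]
    exact (hA.sub hW).const_mul _
  have hBE : ∀ t ∈ Set.Icc (0 : ℝ) τ, ∀ ζ : Config (N + 1) (Fin 3) T3,
      |enskogRate σ N χ g (evenMarkTrunc k l L) r t ζ| ≤ (σ ^ 3)⁻¹ * (BA + BW) := by
    intro t ht ζ
    rw [he_eq, abs_mul, abs_of_pos (inv_pos.2 hσ3)]
    refine mul_le_mul_of_nonneg_left ((abs_sub _ _).trans (add_le_add (hBA t ht ζ) (hBW t ht ζ))) ?_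
    positivity
  exact ⟨integrableOn_orbit_of_measurable_bounded hz hA hBA, integrableOn_orbit_of_measurable_bounded hz hE hBE⟩

/-- **Rung 0 (constant profiles): S2\* from the three residual concentrations**, the same proof as
`stub_cylinderPullbackOfResiduals` specialised pointwise in the profile. [folklore] -/
theorem cylinderPullbackStar_rung0_of_residuals :
    (∃ η₀ : ℝ, 0 < η₀ ∧ ∀ (a θ : ℝ) (u : V3), 0 < a → 0 < θ → ∃ σ₀ : ℝ, 0 < σ₀ ∧ ∀ σ : ℝ, 0 < σ → σ < σ₀ → ∀ Φ : (N : ℕ) → HardSphereFlow (Torus.geometry (Fin 3)) (hsDiameter σ N) (N + 1), ∀ τ : ℝ, 0 < τ → ∀ χ : ℝ × UnitAddTorus (Fin 3) → ℝ, Continuous χ → ∀ g : ℝ → ℝ, Continuous g → (∀ a, η₀ ≤ a → g a = 0) → ∀ η δ : ℝ, 0 < η → 0 < δ → ∃ r₀ : ℝ, 0 < r₀ ∧ ∀ r : ℝ, 0 < r → r < r₀ → ∀ L : ℝ, 1 ≤ L → ∃ κ₀ : ℝ, 0 < κ₀ ∧ ∀ κ : ℝ, 0 < κ → κ < κ₀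 → ∃ N₀ : ℕ, ∀ N : ℕ, N₀ ≤ N → ∀ k l : Fin 3, localGibbsLaw σ (fun _ => a) (fun _ => u) (fun _ => θ) N (Φ N) {z | η < ((N + 1 : ℝ) * κ)⁻¹ * continuityCorrection σ N (Φ N) τ χ g (evenMarkTrunc k l L) r κ z} ≤ ENNReal.ofReal δ) → (∃ η₀ : ℝ, 0 < η₀ ∧ ∀ (a θ : ℝ) (u : V3), 0 < a → 0 < θ → ∃ σ₀ : ℝ, 0 < σ₀ ∧ ∀ σ : ℝ, 0 < σ → σ < σ₀ → ∀ Φ : (N : ℕ) → HardSphereFlow (Torus.geometry (Fin 3)) (hsDiameter σ N) (N + 1), ∀ τ : ℝ, 0 < τ → ∀ χ : ℝ × UnitAddTorus (Fin 3) → ℝ, Continuous χ → ∀ g : ℝ → ℝ, Continuous g → (∀ a, η₀ ≤ a → g a = 0) → ∀ η δ : ℝ, 0 < η → 0 < δ → ∃ r₀ : ℝ, 0 < r₀ ∧ ∀ r : ℝ, 0 < r → r < r₀ → ∀ L : ℝ, 1 ≤ L → ∃ κ₀ : ℝ, 0 < κ₀ ∧ ∀ κ : ℝ, 0 < κ → κ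 < κ₀ → ∃ N₀ : ℕ, ∀ N : ℕ, N₀ ≤ N → ∀ k l : Fin 3, localGibbsLaw σ (fun _ => a) (fun _ => u) (fun _ => θ) N (Φ N) {z | η < ((N + 1 : ℝ) * κ)⁻¹ * shortFlightDeficit σ N (Φ N) τ (evenMarkTrunc k l L) κ z} ≤ ENNReal.ofReal δ) → (∀ (a θ : ℝ) (u : V3), 0 < a → 0 < θ → ∃ σ₀ : ℝ, 0 < σ₀ ∧ ∀ σ : ℝ, 0 < σ → σ < σ₀ → ∀ Φ : (N : ℕ) → HardSphereFlow (Torus.geometry (Fin 3)) (hsDiameter σ N) (N + 1), ∀ τ : ℝ, 0 < τ → ∀ η δ : ℝ, 0 < η → 0 < δ → ∀ L : ℝ, 1 ≤ L → ∃ κ₀ : ℝ, 0 < κ₀ ∧ ∀ κ : ℝ, 0 < κ → κ < κ₀ → ∃ N₀ : ℕ, ∀ N : ℕ, N₀ ≤ N → localGibbsLaw σ (fun _ => a) (fun _ => u) (fun _ => θ) N (Φ N) {z | η < hsDiameter σ N / (N + 1 : ℝ) * threeBodyCollisionSum σ N (Φ N) τ L κ z} ≤ ENNReal.ofReal δ)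 → ∃ η₀ : ℝ, 0 < η₀ ∧ ∀ (a θ : ℝ) (u : V3), 0 < a → 0 < θ → ∃ σ₀ : ℝ, 0 < σ₀ ∧ ∀ σ : ℝ, 0 < σ → σ < σ₀ → ∀ Φ : (N : ℕ) → HardSphereFlow (Torus.geometry (Fin 3)) (hsDiameter σ N) (N + 1), ∀ τ : ℝ, 0 < τ → ∀ χ : ℝ × UnitAddTorus (Fin 3) → ℝ, Continuous χ → ∀ g : ℝ → ℝ, Continuous g → (∀ a, η₀ ≤ a → g a = 0) → ∀ η δ : ℝ, 0 < η → 0 < δ → ∃ r₀ : ℝ, 0 < r₀ ∧ ∀ r : ℝ, 0 < r → r < r₀ → ∀ L : ℝ, 1 ≤ L → ∃ κ₀ : ℝ, 0 < κ₀ ∧ ∀ κ : ℝ, 0 < κ → κ < κ₀ → ∃ N₀ : ℕ, ∀ N : ℕ, N₀ ≤ N → ∀ k l : Fin 3, localGibbsLaw σ (fun _ => a) (fun _ => u) (fun _ => θ) N (Φ N) {z | η < |collisionSum σ N (Φ N) τ χ g (evenMarkTrunc k l L) r z - tubeTimeStat σ N (Φ N) τ χ g (evenMarkTrunc k l L) r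 r 1 κ z|} ≤ ENNReal.ofReal δ := by
  intro h1 h2 h3
  obtain ⟨η₁, hη₁, H1⟩ := h1
  obtain ⟨η₂, hη₂, H2⟩ := h2
  refine ⟨min η₁ η₂, lt_min hη₁ hη₂, ?_⟩
  intro a θ u ha hθ
  obtain ⟨σ₁, hσ₁, H1⟩ := H1 a θ u ha hθ
  obtain ⟨σ₂, hσ₂, H2⟩ := H2 a θ u ha hθ
  obtain ⟨σ₃, hσ₃, H3⟩ := h3 a θ u ha hθ
  obtain ⟨σ₄, hσ₄, H4⟩ := residual_latePairs (fun _ => a) (fun _ => θ) (fun _ => u)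
    continuous_const continuous_const continuous_const (fun _ => ha) (fun _ => hθ)
  refine ⟨min (min (min σ₁ σ₂) (min σ₃ σ₄)) (1 / 4),
    lt_min (lt_min (lt_min hσ₁ hσ₂) (lt_min hσ₃ hσ₄)) (by norm_num), ?_⟩
  intro σ hσ hσlt Φ τ hτ χ hχ g hg hg0 η δ hη hδ
  have hσ4 : σ < 1 / 4 := lt_of_lt_of_le hσlt (min_le_right _ _)
  have hσ' : σ < min (min σ₁ σ₂) (min σ₃ σ₄) := lt_of_lt_of_le hσlt (min_le_left _ _)
  have hσ₁' : σ < σ₁ := lt_of_lt_of_le hσ' ((min_le_left _ _).trans (min_le_left _ _))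
  have hσ₂' : σ < σ₂ := lt_of_lt_of_le hσ' ((min_le_left _ _).trans (min_le_right _ _))
  have hσ₃' : σ < σ₃ := lt_of_lt_of_le hσ' ((min_le_right _ _).trans (min_le_left _ _))
  have hσ₄' : σ < σ₄ := lt_of_lt_of_le hσ' ((min_le_right _ _).trans (min_le_right _ _))
  have hg1 : ∀ a, η₁ ≤ a → g a = 0 := fun a h => hg0 a ((min_le_left _ _).trans h)
  have hg2 : ∀ a, η₂ ≤ a → g a = 0 := fun a h => hg0 a ((min_le_right _ _).trans h)
  -- sup constants of `χ` on `[0, τ] × 𝕋³` and of `g` on `[0, ∞)`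
  obtain ⟨Cχ, hCχ⟩ := (isCompact_Icc.prod isCompact_univ :
    IsCompact (Icc (0 : ℝ) τ ×ˢ (univ : Set (UnitAddTorus (Fin 3))))).exists_bound_of_continuousOn hχ.continuousOn
  have hχb : ∀ t ∈ Icc (0 : ℝ) τ, ∀ x, |χ (t, x)| ≤ Cχ := fun t ht x => by
    simpa only [Real.norm_eq_abs] using hCχ (t, x) ⟨ht, mem_univ _⟩
  obtain ⟨Cg, hCg⟩ := (isCompact_Icc (a := (0 : ℝ)) (b := min η₁ η₂)).exists_bound_of_continuousOn hg.continuousOn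
  have hCg0 : 0 ≤ Cg := (norm_nonneg _).trans (hCg 0 ⟨le_rfl, (lt_min hη₁ hη₂).le⟩)
  have hgb : ∀ a, 0 ≤ a → |g a| ≤ Cg := by
    intro a ha0'
    rcases le_or_gt a (min η₁ η₂) with hle | hlt
    · simpa only [Real.norm_eq_abs] using hCg a ⟨ha0', hle⟩
    · rw [hg0 a hlt.le, abs_zero]; exact hCg0
  have hCχ0 : 0 ≤ Cχ := (abs_nonneg _).trans (hχb 0 ⟨le_rfl, hτ.le⟩ 0)
  have hCC : 0 ≤ Cχ * Cg := mul_nonneg hCχ0 hCg0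
  -- accuracies (those of `h3`, `h4` are chosen after `L`)
  have hη4 : 0 < η / 4 := by positivity
  have hδ4 : 0 < δ / 4 := by positivity
  have hη2 : 0 < η / (4 * (Cχ * Cg + 1)) := by positivity
  obtain ⟨r₁, hr₁, H1⟩ := H1 σ hσ hσ₁' Φ τ hτ χ hχ g hg hg1 (η / 4) (δ / 4) hη4 hδ4
  obtain ⟨r₂, hr₂, H2⟩ := H2 σ hσ hσ₂' Φ τ hτ χ hχ g hg hg2 (η / (4 * (Cχ * Cg + 1))) (δ / 4) hη2 hδ4
  refine ⟨min r₁ r₂, lt_min hr₁ hr₂, ?_⟩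
  intro r hr hrlt L hL
  have hL0 : 0 < L := one_pos.trans_le hL
  have hr1 : r < r₁ := lt_of_lt_of_le hrlt (min_le_left _ _)
  have hr2 : r < r₂ := lt_of_lt_of_le hrlt (min_le_right _ _)
  have hη3 : 0 < η / (4 * (2 * (Cχ * Cg * (2 * L)) + 1)) := by positivity
  have hη4' : 0 < η / (4 * (Cχ * Cg * (2 * L) + 1)) := by positivity
  obtain ⟨κ₁, hκ₁, H1⟩ := H1 r hr hr1 L hL
  obtain ⟨κ₂, hκ₂, H2⟩ := H2 r hr hr2 L hL
  obtain ⟨κ₃, hκ₃, H3⟩ := H3 σ hσ hσ₃' Φ τ hτ (η / (4 * (2 * (Cχ * Cg * (2 * L)) + 1))) (δ / 4) hη3 hδ4 L hL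
  obtain ⟨κ₄, hκ₄, H4⟩ := H4 σ hσ hσ₄' Φ τ hτ (η / (4 * (Cχ * Cg * (2 * L) + 1))) (δ / 4) hη4' hδ4 L hL
  refine ⟨min (min (min κ₁ κ₂) (min κ₃ κ₄)) (1 / (4 * L)),
    lt_min (lt_min (lt_min hκ₁ hκ₂) (lt_min hκ₃ hκ₄)) (by positivity), ?_⟩
  intro κ hκ hκlt
  have hκ' : κ < min (min κ₁ κ₂) (min κ₃ κ₄) := lt_of_lt_of_le hκlt (min_le_left _ _)
  have hκL : κ < 1 / (4 * L) := lt_of_lt_of_le hκlt (min_le_right _ _)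
  have hκ₁' : κ < κ₁ := lt_of_lt_of_le hκ' ((min_le_left _ _).trans (min_le_left _ _))
  have hκ₂' : κ < κ₂ := lt_of_lt_of_le hκ' ((min_le_left _ _).trans (min_le_right _ _))
  have hκ₃' : κ < κ₃ := lt_of_lt_of_le hκ' ((min_le_right _ _).trans (min_le_left _ _))
  have hκ₄' : κ < κ₄ := lt_of_lt_of_le hκ' ((min_le_right _ _).trans (min_le_right _ _))
  obtain ⟨N₁, H1⟩ := H1 κ hκ hκ₁'
  obtain ⟨N₂, H2⟩ := H2 κ hκ hκ₂'
  obtain ⟨N₃, H3⟩ := H3 κ hκ hκ₃'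
  obtain ⟨N₄, H4⟩ := H4 κ hκ hκ₄'
  refine ⟨max (max N₁ N₂) (max N₃ N₄), fun N hN k l => ?_⟩
  have hN1 : N₁ ≤ N := ((le_max_left _ _).trans (le_max_left _ _)).trans hN
  have hN2 : N₂ ≤ N := ((le_max_right _ _).trans (le_max_left _ _)).trans hN
  have hN3 : N₃ ≤ N := ((le_max_left _ _).trans (le_max_right _ _)).trans hN
  have hN4 : N₄ ≤ N := ((le_max_right _ _).trans (le_max_right _ _)).trans hN
  have E1 := H1 N hN1 k l
  have E2 := H2 N hN2 k l
  have E3 := H3 N hN3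
  have E4 := H4 N hN4
  -- the minimal-image smallness `ε (1 + 2 L κ) < 1/2`
  have hLκ : 2 * L * κ ≤ 1 / 2 := by
    have : L * κ ≤ L * (1 / (4 * L)) := mul_le_mul_of_nonneg_left hκL.le hL0.le
    rw [show L * (1 / (4 * L)) = 1 / 4 by field_simp] at this
    linarith
  have hsmall : hsDiameter σ N * (1 + 2 * L * κ) < 1 / 2 := by
    have hε := hsDiameter_le hσ.le N
    have hε0 := (hsDiameter_pos hσ N).le
    nlinarith
  -- the mark
  have hΨc := continuous_evenMarkTrunc k l L
  have hΨb : ∀ p, |evenMarkTrunc k l L p| ≤ 2 * L := abs_evenMarkTrunc_le k l hL0.le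
  have hΨ0 : ∀ n v w : V3, 2 * L ≤ ‖w - v‖ → evenMarkTrunc k l L (n, v, w) = 0 :=
    fun n v w h => evenMarkTrunc_eq_zero_of_le k l hL0 h
  -- the union bound on the good set
  set P := localGibbsLaw σ (fun _ => a) (fun _ => u) (fun _ => θ) N (Φ N) with hP
  set S₁ := {z : Config (N + 1) (Fin 3) T3 | η / 4 <
    ((N + 1 : ℝ) * κ)⁻¹ * continuityCorrection σ N (Φ N) τ χ g (evenMarkTrunc k l L) r κ z} with hS₁
  set S₂ := {z : Config (N + 1) (Fin 3) T3 | η / (4 * (Cχ * Cg + 1)) <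
    ((N + 1 : ℝ) * κ)⁻¹ * shortFlightDeficit σ N (Φ N) τ (evenMarkTrunc k l L) κ z} with hS₂
  set S₃ := {z : Config (N + 1) (Fin 3) T3 | η / (4 * (2 * (Cχ * Cg * (2 * L)) + 1)) <
    hsDiameter σ N / (N + 1 : ℝ) * threeBodyCollisionSum σ N (Φ N) τ L κ z} with hS₃
  set S₄ := {z : Config (N + 1) (Fin 3) T3 | η / (4 * (Cχ * Cg * (2 * L) + 1)) <
    hsDiameter σ N / (N + 1 : ℝ) * pairShellCount σ N L κ ((Φ N).flow τ z)} with hS₄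
  set E := {z : Config (N + 1) (Fin 3) T3 | η <
    |collisionSum σ N (Φ N) τ χ g (evenMarkTrunc k l L) r z -
      tubeTimeStat σ N (Φ N) τ χ g (evenMarkTrunc k l L) r r 1 κ z|} with hE
  have hsub : E ∩ (Φ N).good ⊆ ((S₁ ∪ S₂) ∪ S₃) ∪ S₄ := by
    rintro z ⟨hz, hgood⟩
    by_contra hnot
    simp only [Set.mem_union, not_or, hS₁, hS₂, hS₃, hS₄, Set.mem_setOf_eq, not_lt] at hnot
    obtain ⟨⟨⟨b1, b2⟩, b3⟩, b4⟩ := hnot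
    have hpath := cylinderPullback_pathwise σ N (Φ N) τ χ g (evenMarkTrunc k l L) r r κ L Cχ Cg (2 * L) z
      hgood hσ hτ hr hκ hL0.le hsmall hχ hg hΨc hχb hgb hΨb hΨ0
    have hc : 0 ≤ ((N + 1 : ℝ) * κ)⁻¹ := by positivity
    have hεN : 0 ≤ hsDiameter σ N / (N + 1 : ℝ) := by
      have := (hsDiameter_pos hσ N).le; positivity
    have t2 : ((N + 1 : ℝ) * κ)⁻¹ * (Cχ * Cg * shortFlightDeficit σ N (Φ N) τ (evenMarkTrunc k l L) κ z) ≤ η / 4 := by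
      calc ((N + 1 : ℝ) * κ)⁻¹ * (Cχ * Cg * shortFlightDeficit σ N (Φ N) τ (evenMarkTrunc k l L) κ z)
          = Cχ * Cg * (((N + 1 : ℝ) * κ)⁻¹ * shortFlightDeficit σ N (Φ N) τ (evenMarkTrunc k l L) κ z) := by ring
        _ ≤ Cχ * Cg * (η / (4 * (Cχ * Cg + 1))) := mul_le_mul_of_nonneg_left b2 hCC
        _ ≤ η / 4 := mul_eta_div_le_r0 hCC hη.le
    have t3 : Cχ * Cg * (2 * L) * (hsDiameter σ N / (N + 1 : ℝ)) *
        (2 * threeBodyCollisionSum σ N (Φ N) τ L κ z) ≤ η / 4 := by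
      calc Cχ * Cg * (2 * L) * (hsDiameter σ N / (N + 1 : ℝ)) * (2 * threeBodyCollisionSum σ N (Φ N) τ L κ z)
          = 2 * (Cχ * Cg * (2 * L)) * (hsDiameter σ N / (N + 1 : ℝ) * threeBodyCollisionSum σ N (Φ N) τ L κ z) := by
            ring
        _ ≤ 2 * (Cχ * Cg * (2 * L)) * (η / (4 * (2 * (Cχ * Cg * (2 * L)) + 1))) :=
            mul_le_mul_of_nonneg_left b3 (by positivity)
        _ ≤ η / 4 := mul_eta_div_le_r0 (by positivity) hη.le
    have t4 : Cχ * Cg * (2 * L) * (hsDiameter σ N / (N + 1 : ℝ)) * pairShellCount σ N L κ ((Φ N).flow τ z) ≤ η / 4 := by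
      calc Cχ * Cg * (2 * L) * (hsDiameter σ N / (N + 1 : ℝ)) * pairShellCount σ N L κ ((Φ N).flow τ z)
          = Cχ * Cg * (2 * L) * (hsDiameter σ N / (N + 1 : ℝ) * pairShellCount σ N L κ ((Φ N).flow τ z)) := by ring
        _ ≤ Cχ * Cg * (2 * L) * (η / (4 * (Cχ * Cg * (2 * L) + 1))) := mul_le_mul_of_nonneg_left b4 (by positivity)
        _ ≤ η / 4 := mul_eta_div_le_r0 (by positivity) hη.le
    have hle : |collisionSum σ N (Φ N) τ χ g (evenMarkTrunc k l L) r z -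
        tubeTimeStat σ N (Φ N) τ χ g (evenMarkTrunc k l L) r r 1 κ z| ≤ η := by
      refine hpath.trans ?_
      rw [mul_add, mul_add]
      linarith
    exact (not_lt.2 hle) hz
  have hgoodc : P (Φ N).goodᶜ = 0 := localGibbsLaw_goodCompl (Φ N)
  calc P E = P (E ∩ (Φ N).good ∪ E \ (Φ N).good) := by rw [Set.inter_union_sdiff]
    _ ≤ P (E ∩ (Φ N).good) + P (E \ (Φ N).good) := measure_union_le _ _
    _ ≤ P (((S₁ ∪ S₂) ∪ S₃) ∪ S₄) + 0 := by
        refine add_le_add (measure_mono hsub) ?_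
        exact (measure_mono fun z hz => hz.2).trans hgoodc.le
    _ ≤ P S₁ + P S₂ + P S₃ + P S₄ := by
        rw [add_zero]
        exact (measure_union_le _ _).trans (add_le_add ((measure_union_le _ _).trans
          (add_le_add (measure_union_le _ _) le_rfl)) le_rfl)
    _ ≤ ENNReal.ofReal (δ / 4) + ENNReal.ofReal (δ / 4) + ENNReal.ofReal (δ / 4) + ENNReal.ofReal (δ / 4) :=
        add_le_add (add_le_add (add_le_add E1 E2) E3) E4
    _ = ENNReal.ofReal δ := by
        rw [← ENNReal.ofReal_add hδ4.le hδ4.le, ← ENNReal.ofReal_add (by positivity) hδ4.le,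
          ← ENNReal.ofReal_add (by positivity) hδ4.le]
        congr 1
        ring

/-- **Rung 0: the registered pull-back S2|const from its tube form S2\*|const**, the same proof as
`stub_cylinderPullbackOfStar` specialised pointwise in the profile (exact Enskog slicing on good orbits from S6 and
the proved equation of state). [folklore] -/
theorem cylinderPullback_rung0_of_star :
    (∃ η₀ : ℝ, 0 < η₀ ∧ ∀ (a θ : ℝ) (u : V3), 0 < a → 0 < θ → ∃ σ₀ : ℝ, 0 < σ₀ ∧ ∀ σ : ℝ, 0 < σ → σ < σ₀ → ∀ Φ : (N : ℕ) → HardSphereFlow (Torus.geometry (Fin 3)) (hsDiameter σ N) (N + 1), ∀ τ : ℝ, 0 < τ → ∀ χ : ℝ × UnitAddTorus (Fin 3) → ℝ, Continuous χ → ∀ g : ℝ → ℝ, Continuous g → (∀ a, η₀ ≤ a → g a = 0) → ∀ η δ : ℝ, 0 < η → 0 < δ → ∃ r₀ : ℝ, 0 < r₀ ∧ ∀ r : ℝ, 0 < r → r < r₀ → ∀ L : ℝ, 1 ≤ L → ∃ κ₀ : ℝ, 0 < κ₀ ∧ ∀ κ : ℝ, 0 < κ → κ < κ₀ → ∃ N₀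 : ℕ, ∀ N : ℕ, N₀ ≤ N → ∀ k l : Fin 3, localGibbsLaw σ (fun _ => a) (fun _ => u) (fun _ => θ) N (Φ N) {z | η < |collisionSum σ N (Φ N) τ χ g (evenMarkTrunc k l L) r z - tubeTimeStat σ N (Φ N) τ χ g (evenMarkTrunc k l L) r r 1 κ z|} ≤ ENNReal.ofReal δ) → ∃ η₀ : ℝ, 0 < η₀ ∧ ∀ (a θ : ℝ) (u : V3), 0 < a → 0 < θ → ∃ σ₀ : ℝ, 0 < σ₀ ∧ ∀ σ : ℝ, 0 < σ → σ < σ₀ → ∀ Φ : (N : ℕ) → HardSphereFlow (Torus.geometry (Fin 3)) (hsDiameter σ N) (N + 1), ∀ τ : ℝ, 0 < τ → ∀ χ : ℝ × UnitAddTorus (Fin 3) → ℝ, Continuous χ → ∀ g : ℝ → ℝ, Continuous g → (∀ a, η₀ ≤ a → g a = 0) → ∀ η δ : ℝ, 0 < η → 0 < δ → ∃ r₀ : ℝ, 0 < r₀ ∧ ∀ r : ℝ, 0 < r → r < r₀ → ∀ L : ℝ, 1 ≤ L → ∃ κ₀ : ℝ, 0 < κ₀ ∧ ∀ κ : ℝ,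 0 < κ → κ < κ₀ → ∃ N₀ : ℕ, ∀ N : ℕ, N₀ ≤ N → ∀ k l : Fin 3, localGibbsLaw σ (fun _ => a) (fun _ => u) (fun _ => θ) N (Φ N) {z | η < |evenStat σ N (Φ N) τ χ g (evenMarkTrunc k l L) r z - evenTubeTimeStat σ N (Φ N) τ χ g (evenMarkTrunc k l L) r κ z|} ≤ ENNReal.ofReal δ := by
  intro hStar
  obtain ⟨η₆, hη₆, H6⟩ := stub_evenTubeStatRegular hsEos_jParity_r0
  obtain ⟨η₁, hη₁, H1⟩ := hStar
  refine ⟨min η₁ η₆, lt_min hη₁ hη₆, ?_⟩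
  intro a θ u ha hθ
  obtain ⟨σ₁, hσ₁, H1⟩ := H1 a θ u ha hθ
  refine ⟨σ₁, hσ₁, ?_⟩
  intro σ hσ hσ1 Φ τ hτ χ hχ g hg hg0 η δ hη hδ
  have hg1 : ∀ a, η₁ ≤ a → g a = 0 := fun a h => hg0 a ((min_le_left _ _).trans h)
  have hg6 : ∀ a, η₆ ≤ a → g a = 0 := fun a h => hg0 a ((min_le_right _ _).trans h)
  obtain ⟨r₁, hr₁, H1⟩ := H1 σ hσ hσ1 Φ τ hτ χ hχ g hg hg1 η δ hη hδ
  refine ⟨r₁, hr₁, ?_⟩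
  intro r hr hrlt L hL
  have hL0 : 0 ≤ L := zero_le_one.trans hL
  obtain ⟨κ₁, hκ₁, H1⟩ := H1 r hr hrlt L hL
  refine ⟨κ₁, hκ₁, ?_⟩
  intro κ hκ hκlt
  obtain ⟨N₁, H1⟩ := H1 κ hκ hκlt
  refine ⟨N₁, fun N hN k l => ?_⟩
  have E1 := H1 N hN k l
  set P := localGibbsLaw σ (fun _ => a) (fun _ => u) (fun _ => θ) N (Φ N) with hP
  set E := {z : Config (N + 1) (Fin 3) T3 | η < |evenStat σ N (Φ N) τ χ g (evenMarkTrunc k l L) r z -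
    evenTubeTimeStat σ N (Φ N) τ χ g (evenMarkTrunc k l L) r κ z|} with hE
  set E' := {z : Config (N + 1) (Fin 3) T3 | η < |collisionSum σ N (Φ N) τ χ g (evenMarkTrunc k l L) r z -
    tubeTimeStat σ N (Φ N) τ χ g (evenMarkTrunc k l L) r r 1 κ z|} with hE'
  have hsub : E ∩ (Φ N).good ⊆ E' := by
    rintro z ⟨hz, hgood⟩
    obtain ⟨hIA, hIe⟩ := integrableOn_A_e_orbit_r0 H6 hgood k l (τ := τ) hσ hχ hg hg6 hL0 hr hκ.le
    have heq := evenStat_sub_evenTubeTimeStat_eq (Φ := Φ N) z hIA hIe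
    rw [hE, Set.mem_setOf_eq, heq] at hz
    exact hz
  have hgoodc : P (Φ N).goodᶜ = 0 := localGibbsLaw_goodCompl (Φ N)
  calc P E = P (E ∩ (Φ N).good ∪ E \ (Φ N).good) := by rw [Set.inter_union_sdiff]
    _ ≤ P (E ∩ (Φ N).good) + P (E \ (Φ N).good) := measure_union_le _ _
    _ ≤ P E' + 0 := by
        refine add_le_add (measure_mono hsub) ?_
        exact (measure_mono fun z hz => hz.2).trans hgoodc.le
    _ ≤ ENNReal.ofReal δ := by rw [add_zero]; exact E1

/-- **Rung 0 glue for S2** (registered helper stub `cylinderPullback_rung0_of_residuals` of the line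
`even-rung-mean-variance`): at constant profiles, the three residual concentrations (continuity correction,
short-flight deficit, three-body collision sum) imply the registered cylinder pull-back S2|const. [folklore] -/
theorem cylinderPullback_rung0_of_residuals :
    (∃ η₀ : ℝ, 0 < η₀ ∧ ∀ (a θ : ℝ) (u : V3), 0 < a → 0 < θ → ∃ σ₀ : ℝ, 0 < σ₀ ∧ ∀ σ : ℝ, 0 < σ → σ < σ₀ → ∀ Φ : (N : ℕ) → HardSphereFlow (Torus.geometry (Fin 3)) (hsDiameter σ N) (N + 1), ∀ τ : ℝ, 0 < τ → ∀ χ : ℝ × UnitAddTorus (Fin 3) → ℝ, Continuous χ → ∀ g : ℝ → ℝ, Continuous g → (∀ a, η₀ ≤ a → g a = 0) → ∀ η δ : ℝ, 0 < η → 0 < δ → ∃ r₀ : ℝ, 0 < r₀ ∧ ∀ r : ℝ, 0 < r → r < r₀ → ∀ L : ℝ, 1 ≤ L → ∃ κ₀ : ℝ, 0 < κ₀ ∧ ∀ κ : ℝ, 0 < κ → κ < κ₀ → ∃ N₀ : ℕ, ∀ N : ℕ, N₀ ≤ N → ∀ k l : Fin 3, localGibbsLaw σ (fun _ => a) (fun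 _ => u) (fun _ => θ) N (Φ N) {z | η < ((N + 1 : ℝ) * κ)⁻¹ * continuityCorrection σ N (Φ N) τ χ g (evenMarkTrunc k l L) r κ z} ≤ ENNReal.ofReal δ) → (∃ η₀ : ℝ, 0 < η₀ ∧ ∀ (a θ : ℝ) (u : V3), 0 < a → 0 < θ → ∃ σ₀ : ℝ, 0 < σ₀ ∧ ∀ σ : ℝ, 0 < σ → σ < σ₀ → ∀ Φ : (N : ℕ) → HardSphereFlow (Torus.geometry (Fin 3)) (hsDiameter σ N) (N + 1), ∀ τ : ℝ, 0 < τ → ∀ χ : ℝ × UnitAddTorus (Fin 3) → ℝ, Continuous χ → ∀ g : ℝ → ℝ, Continuous g → (∀ a, η₀ ≤ a → g a = 0) → ∀ η δ : ℝ, 0 < η → 0 < δ → ∃ r₀ : ℝ, 0 < r₀ ∧ ∀ r : ℝ, 0 < r → r < r₀ → ∀ L : ℝ, 1 ≤ L → ∃ κ₀ : ℝ, 0 < κ₀ ∧ ∀ κ : ℝ, 0 < κ → κ < κ₀ → ∃ N₀ : ℕ, ∀ N : ℕ, N₀ ≤ N → ∀ k l : Fin 3, localGibbsLaw σ (fun _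 => a) (fun _ => u) (fun _ => θ) N (Φ N) {z | η < ((N + 1 : ℝ) * κ)⁻¹ * shortFlightDeficit σ N (Φ N) τ (evenMarkTrunc k l L) κ z} ≤ ENNReal.ofReal δ) → (∀ (a θ : ℝ) (u : V3), 0 < a → 0 < θ → ∃ σ₀ : ℝ, 0 < σ₀ ∧ ∀ σ : ℝ, 0 < σ → σ < σ₀ → ∀ Φ : (N : ℕ) → HardSphereFlow (Torus.geometry (Fin 3)) (hsDiameter σ N) (N + 1), ∀ τ : ℝ, 0 < τ → ∀ η δ : ℝ, 0 < η → 0 < δ → ∀ L : ℝ, 1 ≤ L → ∃ κ₀ : ℝ, 0 < κ₀ ∧ ∀ κ : ℝ, 0 < κ → κ < κ₀ → ∃ N₀ : ℕ, ∀ N : ℕ, N₀ ≤ N → localGibbsLaw σ (fun _ => a) (fun _ => u) (fun _ => θ) N (Φ N) {z | η < hsDiameter σ N / (N + 1 : ℝ) * threeBodyCollisionSum σ N (Φ N) τ L κ z} ≤ ENNReal.ofReal δ) → ∃ η₀ : ℝ, 0 < η₀ ∧ ∀ (a θ : ℝ) (u : V3), 0 < a → 0 < θ → ∃ σ₀ :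 ℝ, 0 < σ₀ ∧ ∀ σ : ℝ, 0 < σ → σ < σ₀ → ∀ Φ : (N : ℕ) → HardSphereFlow (Torus.geometry (Fin 3)) (hsDiameter σ N) (N + 1), ∀ τ : ℝ, 0 < τ → ∀ χ : ℝ × UnitAddTorus (Fin 3) → ℝ, Continuous χ → ∀ g : ℝ → ℝ, Continuous g → (∀ a, η₀ ≤ a → g a = 0) → ∀ η δ : ℝ, 0 < η → 0 < δ → ∃ r₀ : ℝ, 0 < r₀ ∧ ∀ r : ℝ, 0 < r → r < r₀ → ∀ L : ℝ, 1 ≤ L → ∃ κ₀ : ℝ, 0 < κ₀ ∧ ∀ κ : ℝ, 0 < κ → κ < κ₀ → ∃ N₀ : ℕ, ∀ N : ℕ, N₀ ≤ N → ∀ k l : Fin 3, localGibbsLaw σ (fun _ => a) (fun _ => u) (fun _ => θ) N (Φ N) {z | η < |evenStat σ N (Φ N) τ χ g (evenMarkTrunc k l L) r z - evenTubeTimeStat σ N (Φ N) τ χ g (evenMarkTrunc k l L) r κ z|} ≤ ENNReal.ofReal δ := by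
  intro h1 h2 h3
  exact cylinderPullback_rung0_of_star (cylinderPullbackStar_rung0_of_residuals h1 h2 h3)

end Summit.AtomisticToContinuum.HydrodynamicLimit.Theorems.EvenStressEnskog

end
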